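import Summits.BirchSwinnertonDyer.BirchSwinnertonDyer.Theses.MordellShaFreeCut
import Summits.BirchSwinnertonDyer.BirchSwinnertonDyer.Theorems.MordellShaFreeCutHeegnerFieldData
import Literature.NumberTheory.EllipticCurves.BSDSelmerCMPConverse
import Literature.NumberTheory.EllipticCurves.ComplexMultiplicationHasCMProofs
import Literature.NumberTheory.EllipticCurves.AnalyticRankModularityProofs

set_option linter.dupNamespace false
set_option autoImplicit false

/-! # Route `MordellShaFreeCut` (rung S2b) — crux `AnalyticRankOneOfRankOneFiniteShaThree`
(stmt-BirchSwinnertonDyer-19160) modulo ONE `K`-level statement, and that statement is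
EQUIVALENT to the crux modulo refereed facts

The registered BC3 skeleton of the crux (line `heegner-field-gz`, plan g8, sha16 f9a75e4a)
composes `stub_heegnerFieldData → stub_threeConverseOverK → AnalyticRankOneOfRankOneFiniteShaThree`.
Its first stub is a tree theorem modulo four REFEREED named facts
(`MordellShaFreeCutHeegnerFieldData.heegnerFieldData_of_parity_of_hoffsteinLuo_of_kato`, p412980:
the `3`-parity theorem `p_parity`, the Modularity Theorem `ModularForms.exists_isNewformOf`,
Hoffstein–Luo 1997 `HoffsteinLuo1997_exists_twist_L_one_ne_zero`, Kato 2004 Cor. 14.3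
`kato_finite_of_L_one_ne_zero`).

1. `analyticRankOne_of_facts_of_threeConverseOverK`: the composition with that helper in place of
   stub 1 — the crux is a tree theorem modulo those four facts and exactly ONE research statement
   carried as a hypothesis, the registered `stub_threeConverseOverK` (token for token); and
   `…_of_large_discr`: the same from the WEAKER hypothesis that the `K`-level converse holds for
   the auxiliary fields the helper actually produces (`|d_K|` beyond any bound, `d_K ≡ 1 (mod 8)`,
   `L(E_D^{(d_K)}, 1) ≠ 0`, given `rank E_D(ℚ) = 1` and `#Ш(E_D/ℚ)[3^∞] < ∞`).
2. `threeConverseOverK_of_crux_of_burungaleTian`: CONVERSELY the crux implies the `K`-level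
   statement — for EVERY quadratic field `K`, with no Heegner hypothesis — modulo the Modularity
   Theorem and Burungale–Tian's rank-ZERO `p`-converse for CM curves (Ann. of Math. 203 (2026)
   Thm. 1.1, tree fact `burungaleTian_analyticRank_eq_zero_of_selmerCorank_eq_zero_of_hasCM`: CM
   `E/ℚ`, ANY prime `p` — so available at the additive prime `3` of `E_D`). Mechanism: the
   quadratic twist of a Mordell curve is a Mordell curve ON THE NOSE,
   `(mordellCurve D).quadraticTwist d = mordellCurve (d³ D)` (`quadraticTwist_mordellCurve`), the
   coranks and ranks over `K` split as `E_D + E_{d_K³ D}` (Dokchitser–Dokchitser 2010 Lemma 4.14 /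
   Silverman Ex. 10.16, tree THEOREMS `selmerCorank_baseChange_quadratic_holds`,
   `mordellWeilRank_baseChange_quadratic_holds`), and so does `ord_{s=1} L(E_D/K, s)` (Artin,
   `analyticRankEK_eq_add_of`); the corank pattern is `(1,0)` or `(0,1)`, the rank sits where the
   corank is (`rank ≤ corank`, Greenberg's identity), the crux handles the corank-one curve and the
   rank-zero converse the other.
3. `threeConverseOverK_iff_crux_of_facts`: hence, modulo `p_parity`, modularity, Hoffstein–Luo,
   Kato and Burungale–Tian's rank-zero fact — all refereed — the registered research stub of the
   line and the crux are EQUIVALENT. Consequence for the plan/tribunal: the line `heegner-field-gz`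
   is a faithful reformulation of crux B (it names WHERE a proof happens — over an auxiliary `K`,
   where Heegner points live — not a logically weaker target); closing `stub_threeConverseOverK`
   is closing the item, and conversely. `threeConverseOverK_of_leaf_of_burungaleTian`: in
   particular the rung LEAF `rankOne_threeConverse_mordellCurve` (Kříž 2020 Thm. 10.13 / Fan–Wan
   v2 Thm. 1.1 shape, unrefereed) implies the stub modulo the same two facts.

Why the remaining statement is research-grade (cell bsd-cn100 VERDICT.md; seat FIND audit
2026-08-26): every refereed rank-ONE `p`-converse consumes Selmer corank one at a prime of GOOD
reduction (Burungale–Tian 2020: ordinary `p > 3`; Burungale–Kobayashi–Ota 2024 Thm. 1.5: inert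
`p ≥ 5`, the landed rung `MordellShaFreeCutRungSupersingular.stub_rung_supersingular`;
Burungale–Skinner, arXiv:2210.10730 App. A: good supersingular), while the hypothesis
`#Ш(E_D/ℚ)[3^∞] < ∞` gives corank one only at `p = 3`, where `E_D : y² = x³ + D` has ADDITIVE
reduction for every `D ≠ 0` (`3 ∣ N(E_D)`: CM by `ℤ[ζ₃]`, `3` ramified). Nothing is asserted here:
every theorem SUPPORTS the item and closes nothing. -/

namespace Summit.BirchSwinnertonDyer.BirchSwinnertonDyer.Theorems.MordellShaFreeCutOfThreeConverseOverK

open Literature.NumberTheory.EllipticCurves WeierstrassCurve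
open Summit.BirchSwinnertonDyer.BirchSwinnertonDyer.Theses.MordellShaFreeCut

/-! ## 1. The crux modulo the registered `K`-level stub -/

/-- **Crux B of route `MordellShaFreeCut` modulo one `K`-level statement.** Granted the
`3`-parity theorem (`hpar`), modularity (`hmod`), Hoffstein–Luo (`hHL`), Kato (`hKato`) and the
registered stub `stub_threeConverseOverK` as the hypothesis `hK3` (verbatim: for `D ≠ 0` and an
imaginary quadratic `K` with the Heegner hypothesis for `N(E_D)` and for `3`,
`corank_{ℤ₃} Sel_{3^∞}(E_D/K) = 1 ∧ rank E_D(K) = 1 ⟹ ord_{s=1} L(E_D/K, s) = 1`), every Mordell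
curve `E_D : y² = x³ + D` (`D ∈ ℚ`, `D ≠ 0`) with `rank E_D(ℚ) = 1` and `#Ш(E_D/ℚ)[3^∞] < ∞` has
`ord_{s=1} L(E_D, s) = 1`. Proof: the landed helper
`heegnerFieldData_of_parity_of_hoffsteinLuo_of_kato` supplies such a `K` with
`ord_{s=1} L(E_D/K, s) = ord_{s=1} L(E_D, s)`; apply `hK3`. -/
theorem analyticRankOne_of_facts_of_threeConverseOverK
    (hpar : ∀ (W : WeierstrassCurve ℚ) [W.IsElliptic] (p : ℕ) [Fact p.Prime], p_parity W p)
    (hmod : ModularForms.exists_isNewformOf) (hHL : HoffsteinLuo1997_exists_twist_L_one_ne_zero)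
    (hKato : ∀ (W : WeierstrassCurve ℚ) [W.IsElliptic] (p : ℕ) [Fact p.Prime],
      kato_finite_of_L_one_ne_zero W p)
    (hK3 : ∀ ⦃D : ℚ⦄, D ≠ 0 → ∀ (K : Type) [Field K] [NumberField K],
      IsImaginaryQuadratic K →
        SatisfiesHeegnerHypothesis ((mordellCurve D).conductorNorm ℤ) K →
          SatisfiesHeegnerHypothesis 3 K →
            ((mordellCurve D).baseChange K).selmerCorank 3 = 1 →
              ((mordellCurve D).baseChange K).mordellWeilRank = 1 →
                analyticRankEK (mordellCurve D) K = 1) :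
    Summit.BirchSwinnertonDyer.BirchSwinnertonDyer.Theses.MordellShaFreeCut.AnalyticRankOneOfRankOneFiniteShaThree := by
  intro D hD hr hfin
  obtain ⟨K, _, _, hK, hHN, hH3, hcK, hrK, hfac⟩ :=
    MordellShaFreeCutHeegnerFieldData.heegnerFieldData_of_parity_of_hoffsteinLuo_of_kato
      hpar hmod hHL hKato hD hr hfin
  have h := hK3 hD K hK hHN hH3 hcK hrK
  rwa [hfac] at h

/-- **The same with the WEAKEST `K`-level hypothesis the line needs.** It suffices to know the
`K`-level Ш-finite `3`-converse for the fields the descent actually produces: for `D ≠ 0` with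
`rank E_D(ℚ) = 1` and `#Ш(E_D/ℚ)[3^∞] < ∞`, SOME bound `B` such that every imaginary quadratic `K`
with `|d_K| > B`, the Heegner hypothesis for `N(E_D)` and for `3`, `d_K ≡ 1 (mod 8)`,
`L(E_D^{(d_K)}, 1) ≠ 0`, `corank_{ℤ₃} Sel_{3^∞}(E_D/K) = 1` and `rank E_D(K) = 1` has
`ord_{s=1} L(E_D/K, s) = 1` (`hK3`; the bound lets a proof discard finitely many auxiliary
fields, e.g. `ℚ(√−3)`, `ℚ(i)`; the rational point of infinite order, the finiteness of
`Ш(E_D/ℚ)[3^∞]` and the non-vanishing twist are data a `3`-adic argument over `K` may consume).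
Proof: `heegnerFieldData_full_of_parity_of_hoffsteinLuo_of_kato` (p412980) with that `B`. -/
theorem analyticRankOne_of_facts_of_threeConverseOverK_of_large_discr
    (hpar : ∀ (W : WeierstrassCurve ℚ) [W.IsElliptic] (p : ℕ) [Fact p.Prime], p_parity W p)
    (hmod : ModularForms.exists_isNewformOf) (hHL : HoffsteinLuo1997_exists_twist_L_one_ne_zero)
    (hKato : ∀ (W : WeierstrassCurve ℚ) [W.IsElliptic] (p : ℕ) [Fact p.Prime],
      kato_finite_of_L_one_ne_zero W p)
    (hK3 : ∀ ⦃D : ℚ⦄, D ≠ 0 → (mordellCurve D).mordellWeilRank = 1 →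
      Finite (AddCommGroup.primaryComponent (mordellCurve D).sha 3) →
        ∃ B : ℕ, ∀ (K : Type) [Field K] [NumberField K],
          IsImaginaryQuadratic K → B < (NumberField.discr K).natAbs →
            SatisfiesHeegnerHypothesis ((mordellCurve D).conductorNorm ℤ) K →
              SatisfiesHeegnerHypothesis 3 K → NumberField.discr K % 8 = 1 →
                ((mordellCurve D).quadraticTwist (NumberField.discr K : ℚ)).entireLFunction 1 ≠ 0 →
                  ((mordellCurve D).baseChange K).selmerCorank 3 = 1 →
                    ((mordellCurve D).baseChange K).mordellWeilRank = 1 →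
                      analyticRankEK (mordellCurve D) K = 1) :
    Summit.BirchSwinnertonDyer.BirchSwinnertonDyer.Theses.MordellShaFreeCut.AnalyticRankOneOfRankOneFiniteShaThree := by
  intro D hD hr hfin
  obtain ⟨B, hB⟩ := hK3 hD hr hfin
  obtain ⟨K, _, _, hK, hdisc, hHN, hH3, hmod8, htw, hcK, hrK, hfac⟩ :=
    MordellShaFreeCutHeegnerFieldData.heegnerFieldData_full_of_parity_of_hoffsteinLuo_of_kato
      hpar hmod hHL hKato hD hr hfin B
  have h := hB K hK hdisc hHN hH3 hmod8 htw hcK hrK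
  rwa [hfac] at h

/-! ## 2. Conversely: the crux implies the `K`-level stub (rank-zero converse at `3`, any `K`) -/

/-- **The quadratic twist of a Mordell curve is a Mordell curve, on the nose**:
`(y² = x³ + D)^{(d)} = (y² = x³ + d³ D)` for the tree's model `quadraticTwist`
(`b₂ = b₄ = 0`, `b₆ = 4D`). [folklore] -/
theorem quadraticTwist_mordellCurve (D d : ℚ) :
    (mordellCurve D).quadraticTwist d = mordellCurve (d ^ 3 * D) := by
  ext
  · rfl
  · simp [quadraticTwist_a₂, mordellCurve, WeierstrassCurve.b₂]
  · rfl
  · simp [quadraticTwist_a₄, mordellCurve, WeierstrassCurve.b₄]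
  · simp [quadraticTwist_a₆, mordellCurve, WeierstrassCurve.b₆]; ring

/-- `E_D` has complex multiplication (`j(E_D) = 0`; tree theorem `hasCM_of_j_eq_zero`). [folklore] -/
theorem hasCM_mordellCurve {D : ℚ} (hD : D ≠ 0) :
    haveI := isElliptic_mordellCurve hD; (mordellCurve D).HasCM := by
  haveI := isElliptic_mordellCurve hD
  exact hasCM_of_j_eq_zero _ ((mordellCurve D).j_eq_zero (mordellCurve_c₄ _))

/-- **Over a quadratic field `K`, `corank_{ℤ₃} Sel_{3^∞}(E_D/K) = 1` forces
`ord_{s=1} L(E_D/K, s) = 1`, granted crux B, modularity and Burungale–Tian's rank-zero converse**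
— the decomposition step. For `D ≠ 0` and `[K : ℚ] = 2` (no Heegner hypothesis, `K` need not be
imaginary) with `corank_{ℤ₃} Sel_{3^∞}(E_D/K) = 1` and `rank E_D(K) = 1`: the Selmer corank and the
rank over `K` are those of `E_D` plus those of `E_D^{(d_K)} = E_{d_K³ D}`
(`selmerCorank_baseChange_quadratic_holds`, `mordellWeilRank_baseChange_quadratic_holds`,
`quadraticTwist_mordellCurve`), so one of the two Mordell curves has `corank 1` and carries the
rational point (its `Ш[3^∞]` is then finite by Greenberg's identity
`selmerCorank_eq_mordellWeilRank_add_holds`) — crux B (`hB`) gives it analytic rank `1` — and the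
other has `corank 0`, hence analytic rank `0` by Burungale–Tian, Ann. of Math. 203 (2026) Thm. 1.1
at `p = 3` (`hBT0`; CM by `quadraticTwist_mordellCurve`/`hasCM_mordellCurve`); Artin formalism
(`analyticRankEK_eq_add_of`, modularity `hmod`) adds them up.
[cite: BurungaleTian2026, Thm. 1.1] [cite: DokchitserDokchitserAnnals2010, Lemma 4.14] -/
theorem analyticRankEK_eq_one_of_crux_of_burungaleTian
    (hmod : ModularForms.exists_isNewformOf)
    (hBT0 : burungaleTian_analyticRank_eq_zero_of_selmerCorank_eq_zero_of_hasCM)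
    (hB : Summit.BirchSwinnertonDyer.BirchSwinnertonDyer.Theses.MordellShaFreeCut.AnalyticRankOneOfRankOneFiniteShaThree)
    {D : ℚ} (hD : D ≠ 0) (K : Type) [Field K] [NumberField K] (hK : Module.finrank ℚ K = 2)
    (hcK : ((mordellCurve D).baseChange K).selmerCorank 3 = 1)
    (hrK : ((mordellCurve D).baseChange K).mordellWeilRank = 1) :
    analyticRankEK (mordellCurve D) K = 1 := by
  haveI := isElliptic_mordellCurve hD
  haveI : Fact (Nat.Prime 3) := ⟨Nat.prime_three⟩
  set d : ℚ := (NumberField.discr K : ℚ) with hd_def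
  have hd : d ≠ 0 := by rw [hd_def]; exact_mod_cast NumberField.discr_ne_zero K
  have hD' : d ^ 3 * D ≠ 0 := mul_ne_zero (pow_ne_zero 3 hd) hD
  haveI := isElliptic_mordellCurve hD'
  have htw : (mordellCurve D).quadraticTwist d = mordellCurve (d ^ 3 * D) :=
    quadraticTwist_mordellCurve D d
  have hadd := analyticRankEK_eq_add_of (hasEntireLFunction_rat_of_exists_isNewformOf hmod)
    (mordellCurve D) K
  have hsel := selmerCorank_baseChange_quadratic_holds (mordellCurve D) K hK 3
  have hrk := mordellWeilRank_baseChange_quadratic_holds (mordellCurve D) K hK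
  rw [htw] at hadd hsel hrk
  rw [hcK] at hsel
  rw [hrK] at hrk
  have hG := (mordellCurve D).selmerCorank_eq_mordellWeilRank_add_holds 3
  have hG' := (mordellCurve (d ^ 3 * D)).selmerCorank_eq_mordellWeilRank_add_holds 3
  rw [hadd]
  by_cases h1 : (mordellCurve D).selmerCorank 3 = 1
  · -- coranks `(1, 0)`: the point is on `E_D`
    have h0 : (mordellCurve (d ^ 3 * D)).selmerCorank 3 = 0 := by omega
    have hr1 : (mordellCurve D).mordellWeilRank = 1 := by omega
    have hsha : (mordellCurve D).shaCorank 3 = 0 := by omega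
    rw [hB hD hr1 ((finite_primaryComponent_sha_iff_shaCorank_eq_zero _ 3).2 hsha),
      hBT0 _ (hasCM_mordellCurve hD') 3 h0]
  · -- coranks `(0, 1)`: the point is on the twist `E_{d³ D}`
    have h0 : (mordellCurve D).selmerCorank 3 = 0 := by omega
    have h1' : (mordellCurve (d ^ 3 * D)).selmerCorank 3 = 1 := by omega
    have hr1 : (mordellCurve (d ^ 3 * D)).mordellWeilRank = 1 := by omega
    have hsha : (mordellCurve (d ^ 3 * D)).shaCorank 3 = 0 := by omega
    rw [hBT0 _ (hasCM_mordellCurve hD) 3 h0,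
      hB hD' hr1 ((finite_primaryComponent_sha_iff_shaCorank_eq_zero _ 3).2 hsha)]

/-- **Crux B ⟹ the registered stub `stub_threeConverseOverK`** (statement after the binders =
the stub, token for token), granted modularity (`hmod`) and Burungale–Tian's rank-zero converse
(`hBT0`). The Heegner hypotheses of the stub are not used. [cite: BurungaleTian2026, Thm. 1.1] -/
theorem threeConverseOverK_of_crux_of_burungaleTian
    (hmod : ModularForms.exists_isNewformOf)
    (hBT0 : burungaleTian_analyticRank_eq_zero_of_selmerCorank_eq_zero_of_hasCM)
    (hB : Summit.BirchSwinnertonDyer.BirchSwinnertonDyer.Theses.MordellShaFreeCut.AnalyticRankOneOfRankOneFiniteShaThree) :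
    ∀ ⦃D : ℚ⦄, D ≠ 0 → ∀ (K : Type) [Field K] [NumberField K],
      IsImaginaryQuadratic K →
        SatisfiesHeegnerHypothesis ((mordellCurve D).conductorNorm ℤ) K →
          SatisfiesHeegnerHypothesis 3 K →
            ((mordellCurve D).baseChange K).selmerCorank 3 = 1 →
              ((mordellCurve D).baseChange K).mordellWeilRank = 1 →
                analyticRankEK (mordellCurve D) K = 1 :=
  fun _ hD K _ _ hK _ _ hcK hrK ↦
    analyticRankEK_eq_one_of_crux_of_burungaleTian hmod hBT0 hB hD K hK.1 hcK hrK

/-! ## 3. The stub and the crux are equivalent modulo refereed facts -/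

/-- **`stub_threeConverseOverK ⟺ crux B`, modulo refereed named facts**: the `3`-parity theorem
(`hpar`, Dokchitser–Dokchitser 2010), the Modularity Theorem (`hmod`), Hoffstein–Luo 1997 (`hHL`),
Kato 2004 (`hKato`) and Burungale–Tian's rank-zero `p`-converse for CM curves (`hBT0`, Ann. of
Math. 2026, any `p`). Forward: `analyticRankOne_of_facts_of_threeConverseOverK`; backward:
`threeConverseOverK_of_crux_of_burungaleTian`. So the line `heegner-field-gz` reformulates crux B
faithfully — its load-bearing stub is neither weaker nor stronger than the item.
[cite: BurungaleTian2026, Thm. 1.1] [cite: DokchitserDokchitserAnnals2010, Thm. 1.4 and Lemma 4.14]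
[cite: HoffsteinLuo1997, Theorem (§1)] [cite: Kato2004Asterisque, Cor. 14.3] -/
theorem threeConverseOverK_iff_crux_of_facts
    (hpar : ∀ (W : WeierstrassCurve ℚ) [W.IsElliptic] (p : ℕ) [Fact p.Prime], p_parity W p)
    (hmod : ModularForms.exists_isNewformOf) (hHL : HoffsteinLuo1997_exists_twist_L_one_ne_zero)
    (hKato : ∀ (W : WeierstrassCurve ℚ) [W.IsElliptic] (p : ℕ) [Fact p.Prime],
      kato_finite_of_L_one_ne_zero W p)
    (hBT0 : burungaleTian_analyticRank_eq_zero_of_selmerCorank_eq_zero_of_hasCM) :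
    (∀ ⦃D : ℚ⦄, D ≠ 0 → ∀ (K : Type) [Field K] [NumberField K],
      IsImaginaryQuadratic K →
        SatisfiesHeegnerHypothesis ((mordellCurve D).conductorNorm ℤ) K →
          SatisfiesHeegnerHypothesis 3 K →
            ((mordellCurve D).baseChange K).selmerCorank 3 = 1 →
              ((mordellCurve D).baseChange K).mordellWeilRank = 1 →
                analyticRankEK (mordellCurve D) K = 1) ↔
      Summit.BirchSwinnertonDyer.BirchSwinnertonDyer.Theses.MordellShaFreeCut.AnalyticRankOneOfRankOneFiniteShaThree :=
  ⟨analyticRankOne_of_facts_of_threeConverseOverK hpar hmod hHL hKato,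
    threeConverseOverK_of_crux_of_burungaleTian hmod hBT0⟩

/-- **The rung leaf implies the stub**, modulo modularity and Burungale–Tian's rank-zero fact:
`rankOne_threeConverse_mordellCurve` (`corank_{ℤ₃} Sel_{3^∞}(E_D) = 1 ⟹ ord_{s=1} L(E_D, s) = 1`
for all `D ≠ 0`; Kříž 2020 Thm. 10.13 / Fan–Wan v2 Thm. 1.1 shape, unrefereed, the ONE binder of
the tree's Sylvester consumers) gives crux B outright (Greenberg's identity turns
`rank 1 ∧ #Ш[3^∞] < ∞` into `corank 1`, tree theorem
`selmerCorank_eq_one_of_mordellWeilRank_eq_one_of_finite`), hence the stub by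
`threeConverseOverK_of_crux_of_burungaleTian`. Bookkeeping for the tribunal: if the leaf becomes
citable, the whole line closes. [cite: Kriz2020, Thm. 10.13] [cite: BurungaleTian2026, Thm. 1.1] -/
theorem threeConverseOverK_of_leaf_of_burungaleTian
    (hmod : ModularForms.exists_isNewformOf)
    (hBT0 : burungaleTian_analyticRank_eq_zero_of_selmerCorank_eq_zero_of_hasCM)
    (hleaf : rankOne_threeConverse_mordellCurve) :
    ∀ ⦃D : ℚ⦄, D ≠ 0 → ∀ (K : Type) [Field K] [NumberField K],
      IsImaginaryQuadratic K →
        SatisfiesHeegnerHypothesis ((mordellCurve D).conductorNorm ℤ) K →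
          SatisfiesHeegnerHypothesis 3 K →
            ((mordellCurve D).baseChange K).selmerCorank 3 = 1 →
              ((mordellCurve D).baseChange K).mordellWeilRank = 1 →
                analyticRankEK (mordellCurve D) K = 1 := by
  refine threeConverseOverK_of_crux_of_burungaleTian hmod hBT0 ?_
  intro D hD hrank hsha
  haveI := isElliptic_mordellCurve hD
  haveI : Fact (Nat.Prime 3) := ⟨Nat.prime_three⟩
  exact hleaf hD (selmerCorank_eq_one_of_mordellWeilRank_eq_one_of_finite _ 3 hrank hsha)

end Summit.BirchSwinnertonDyer.BirchSwinnertonDyer.Theorems.MordellShaFreeCutOfThreeConverseOverK
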